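import Summits.QuantumFields.YangMills.Theorems.AllWindowsColdBoxBoxMidWindowsSU22LineDefs
import Mathlib.Analysis.Complex.ExponentialBounds
import Summits.QuantumFields.YangMills.Theorems.WeakCouplingRatesEventuallyPow
import Summits.QuantumFields.YangMills.Theorems.WeakCouplingRatesColdBoxLargeFieldSU2
import HarnessLib

/-!
# LINE-17 «hypercontractive second-order tilt expansion» on crux `AllWindowsColdBox.BoxMidWindowsSU22` (stmt-QuantumFields-24003):
# the `β → ∞` thresholds of the second clause `∫ e^{4|W|} dν ≤ 4` of stub E (STUB-PLAN-E §2 E(7)–E(8): the CAP CONDITIONS)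

The assembly of the second clause of `TiltMoments θ` (`0 < θ ≤ 1/16`, `ε = epsOf θ = 17θ/8`, `H = ⌈β^θ⌉`, link radius `R = 2·etaOf`)
feeds three pieces `X₁ = V₃` (cubic chaos, `m = 3`), `X₂ = 13440β·Σ‖a_e‖⁴` (`m = 4`), `X₃ = 2C₂Σ‖a_e‖²` (`m = 2`) to
`…CappedExpMoment.setIntegral_exp_mul_abs_le_of_moments` (`λ = 12`), whose cap condition is `Δ = e²λ²s(λM+4)^{m−2} ≤ 1/100`, and
closes with `cond_bound_le_four` (event mass `≥ 9/10`, `e^{4c₀} ≤ 11/10`).  This file proves that ALL these numerical conditions hold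
eventually in `β`, by the box-side bookkeeping of `WeakCouplingRatesEventuallyPow` (`S = 2H+3 ≤ 7β^θ`):

* §1 pure real algebra: with `R ≤ 9S²u` (`u = β^{ε−1/2}`), `#E_f ≤ 4S⁴`, `#touching ≤ 120S⁴`, `16H ≤ 8S`, `e² ≤ 8`, each `Δ_i` and each
  mean is dominated by one or two MONOMIALS `C·S^k·u^j·β^{−a}`: `Δ₁ ≲ K₁S¹⁶u³ + K₁S⁶β⁻¹`, `Δ₂ ≲ D⁴S³⁶u⁸ + D⁴S¹²β⁻²`, `Δ₃ ≲ C₂²D²S¹⁰β⁻²`,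
  means `≲ K₁S⁶β⁻¹, D²S⁶β⁻¹, C₂DS⁵β⁻¹`, radius `R ≲ S²u`;
* §2 **`eventually_expClauseThresholds`**: for `0 < θ ≤ 1/16` every monomial tends to `0` (exponents `16θ+3ε−3/2 ≤ 179/128−3/2 < 0`,
  `36θ+8ε−4 < 0`, `2θ+ε−1/2 < 0`, …), so beyond a threshold: `β ≥ 10`, `R ≤ 1/4`, `R ≤ r₂`, `Δ₁, Δ₂, Δ₃ ≤ 1/100` (with the variance
  inputs `s₁ = K₁(2H+3)⁶/β` of the cubic piece, `ŝ₂ = (13440β)²·105D⁴#E_f²(16H)⁴/β⁴`, `ŝ₃ = (2C₂)²·3D²#E_f²(16H)²/β²` and the caps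
  `M₁ = 24·#touching·β·R³`, `M₂ = 13440β·#E_f·R⁴`, `M₃ = 2C₂#E_f R²`), and the three means `≤ 1/400`, `s₁ ≤ 1/320000`.

Pure bookkeeping; no definition; standard axioms.  HONEST LABEL: helper toward the OPEN registered stub E `stub_tiltMoments` of one
critic-PASSed line on the R2ξ″ RECORD-rung crux 24003; no stub by name, no crux, rung or summit; the Yang–Mills mass gap is NOT proved here.
-/

set_option autoImplicit false

noncomputable section

open Finset
open Literature.MathematicalPhysics.QuantumLattice
open Literature.MathematicalPhysics.QuantumFieldTheory
open Summit.QuantumFields.YangMills.Theorems.WeakCouplingRates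
open Summit.QuantumFields.YangMills.Theorems.ColdBoxAllGroups
open Summit.QuantumFields.YangMills.Theorems.FreeEnergyLogCoefficient

namespace Summit.QuantumFields.YangMills.Theorems.AllWindowsColdBoxBoxMidLine

/-! ## §1 Real algebra: the cap conditions are dominated by monomials -/

section Algebra

/-- `(12M+4)² ≤ 288M² + 32`. -/
theorem sq_twelve_mul_add_four_le (M : ℝ) : (12 * M + 4) ^ 2 ≤ 288 * M ^ 2 + 32 := by
  nlinarith [sq_nonneg (12 * M - 4)]

/-- **`Δ₁` (cubic piece, `m = 3`)**: `e²·12²·(K₁S⁶/β)·(12·(24·N_P·β·R³)+4) ≤ 1/100` once the monomials `K₁S¹⁶u³`, `K₁S⁶β⁻¹` are small. -/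
theorem deltaOne_le {e2 K₁ S u β NP R : ℝ} (he2 : e2 ≤ 8) (hK : 0 ≤ K₁) (hu : 0 ≤ u) (hβ : 0 < β)
    (hNP0 : 0 ≤ NP) (hNP : NP ≤ 120 * S ^ 4) (hR0 : 0 ≤ R) (hR : R ≤ 9 * S ^ 2 * u)
    (m1 : 200 * (8 * 144 * 12 * 24 * 120 * 9 ^ 3) * (K₁ * S ^ 16 * u ^ 3) ≤ 1) (m2 : 200 * (8 * 144 * 4) * (K₁ * S ^ 6 * β⁻¹) ≤ 1) :
    e2 * 12 ^ 2 * (K₁ * S ^ 6 / β) * (12 * (24 * NP * β * R ^ 3) + 4) ^ (3 - 2) ≤ 1 / 100 := by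
  have hR3 : R ^ 3 ≤ (9 * S ^ 2 * u) ^ 3 := pow_le_pow_left₀ hR0 hR 3
  have hin : 12 * (24 * NP * β * R ^ 3) + 4 ≤ 12 * (24 * (120 * S ^ 4) * β * (9 * S ^ 2 * u) ^ 3) + 4 := by gcongr
  have hs0 : 0 ≤ K₁ * S ^ 6 / β := by positivity
  calc e2 * 12 ^ 2 * (K₁ * S ^ 6 / β) * (12 * (24 * NP * β * R ^ 3) + 4) ^ (3 - 2)
      = e2 * 144 * (K₁ * S ^ 6 / β) * (12 * (24 * NP * β * R ^ 3) + 4) := by norm_num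
    _ ≤ 8 * 144 * (K₁ * S ^ 6 / β) * (12 * (24 * (120 * S ^ 4) * β * (9 * S ^ 2 * u) ^ 3) + 4) := by gcongr
    _ = (8 * 144 * 12 * 24 * 120 * 9 ^ 3) * (K₁ * S ^ 16 * u ^ 3) + (8 * 144 * 4) * (K₁ * S ^ 6 * β⁻¹) := by
        field_simp
    _ ≤ 1 / 200 + 1 / 200 := add_le_add (by linarith) (by linarith)
    _ = 1 / 100 := by norm_num

/-- **`Δ₂` (quartic dominator, `m = 4`)**: `e²·12²·ŝ₂·(12M₂+4)² ≤ 1/100` with `ŝ₂ = (13440β)²·105D⁴N_E²(16H)⁴/β⁴`, `M₂ = 13440β·N_E·R⁴`, once the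
monomials `D⁴S³⁶u⁸`, `D⁴S¹²β⁻²` are small. -/
theorem deltaTwo_le {e2 D S u β NE Hr R : ℝ} (he2 : e2 ≤ 8) (hβ : 0 < β)
    (hNE0 : 0 ≤ NE) (hNE : NE ≤ 4 * S ^ 4) (hH0 : 0 ≤ Hr) (hH : 16 * Hr ≤ 8 * S) (hR0 : 0 ≤ R) (hR : R ≤ 9 * S ^ 2 * u)
    (m3 : 200 * (8 * 144 * 288 * (13440 ^ 2 * 105 * 4 ^ 2 * 8 ^ 4) * (13440 ^ 2 * 4 ^ 2 * 9 ^ 8)) * (D ^ 4 * S ^ 36 * u ^ 8) ≤ 1)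
    (m4 : 200 * (8 * 144 * 32 * (13440 ^ 2 * 105 * 4 ^ 2 * 8 ^ 4)) * (D ^ 4 * S ^ 12 * (β ^ 2)⁻¹) ≤ 1) :
    e2 * 12 ^ 2 * ((13440 * β) ^ 2 * (105 * D ^ 4 * NE ^ 2 * (16 * Hr) ^ 4 / β ^ 4)) *
        (12 * (13440 * β * (NE * R ^ 4)) + 4) ^ (4 - 2) ≤ 1 / 100 := by
  have hR4 : R ^ 4 ≤ (9 * S ^ 2 * u) ^ 4 := pow_le_pow_left₀ hR0 hR 4
  have hM : 13440 * β * (NE * R ^ 4) ≤ 13440 * β * (4 * S ^ 4 * (9 * S ^ 2 * u) ^ 4) := by gcongr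
  have hM0 : 0 ≤ 13440 * β * (NE * R ^ 4) := by positivity
  have hsq : (12 * (13440 * β * (NE * R ^ 4)) + 4) ^ (4 - 2) ≤ 288 * (13440 * β * (4 * S ^ 4 * (9 * S ^ 2 * u) ^ 4)) ^ 2 + 32 := by
    rw [show (4 - 2 : ℕ) = 2 from rfl]
    refine (sq_twelve_mul_add_four_le _).trans ?_
    have := pow_le_pow_left₀ hM0 hM 2
    linarith
  have hs : (13440 * β) ^ 2 * (105 * D ^ 4 * NE ^ 2 * (16 * Hr) ^ 4 / β ^ 4) ≤
      (13440 * β) ^ 2 * (105 * D ^ 4 * (4 * S ^ 4) ^ 2 * (8 * S) ^ 4 / β ^ 4) := by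
    have h16 : 0 ≤ 16 * Hr := by positivity
    gcongr
  have hs0 : 0 ≤ (13440 * β) ^ 2 * (105 * D ^ 4 * NE ^ 2 * (16 * Hr) ^ 4 / β ^ 4) := by positivity
  have hq0 : 0 ≤ (12 * (13440 * β * (NE * R ^ 4)) + 4) ^ (4 - 2) := by positivity
  calc e2 * 12 ^ 2 * ((13440 * β) ^ 2 * (105 * D ^ 4 * NE ^ 2 * (16 * Hr) ^ 4 / β ^ 4)) *
        (12 * (13440 * β * (NE * R ^ 4)) + 4) ^ (4 - 2)
      ≤ 8 * 12 ^ 2 * ((13440 * β) ^ 2 * (105 * D ^ 4 * (4 * S ^ 4) ^ 2 * (8 * S) ^ 4 / β ^ 4)) *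
        (288 * (13440 * β * (4 * S ^ 4 * (9 * S ^ 2 * u) ^ 4)) ^ 2 + 32) := by gcongr
    _ = (8 * 144 * 288 * (13440 ^ 2 * 105 * 4 ^ 2 * 8 ^ 4) * (13440 ^ 2 * 4 ^ 2 * 9 ^ 8)) * (D ^ 4 * S ^ 36 * u ^ 8) +
        (8 * 144 * 32 * (13440 ^ 2 * 105 * 4 ^ 2 * 8 ^ 4)) * (D ^ 4 * S ^ 12 * (β ^ 2)⁻¹) := by
        field_simp; ring
    _ ≤ 1 / 200 + 1 / 200 := add_le_add (by linarith) (by linarith)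
    _ = 1 / 100 := by norm_num

/-- **`Δ₃` (quadratic dominator, `m = 2`)**: `e²·12²·ŝ₃·(12M₃+4)⁰ ≤ 1/100` with `ŝ₃ = (2C₂)²·3D²N_E²(16H)²/β²`, once `C₂²D²S¹⁰β⁻²` is small. -/
theorem deltaThree_le {e2 D S β NE Hr C₂ M : ℝ} (he2 : e2 ≤ 8) (hβ : 0 < β)
    (hNE0 : 0 ≤ NE) (hNE : NE ≤ 4 * S ^ 4) (hH0 : 0 ≤ Hr) (hH : 16 * Hr ≤ 8 * S)
    (m5 : 100 * (8 * 144 * 4 * 3 * 4 ^ 2 * 8 ^ 2) * (C₂ ^ 2 * D ^ 2 * S ^ 10 * (β ^ 2)⁻¹) ≤ 1) :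
    e2 * 12 ^ 2 * ((2 * C₂) ^ 2 * (3 * D ^ 2 * NE ^ 2 * (16 * Hr) ^ 2 / β ^ 2)) * (12 * M + 4) ^ (2 - 2) ≤ 1 / 100 := by
  rw [show (2 - 2 : ℕ) = 0 from rfl, pow_zero, mul_one]
  have h16 : 0 ≤ 16 * Hr := by positivity
  have hs0 : 0 ≤ (2 * C₂) ^ 2 * (3 * D ^ 2 * NE ^ 2 * (16 * Hr) ^ 2 / β ^ 2) := by positivity
  calc e2 * 12 ^ 2 * ((2 * C₂) ^ 2 * (3 * D ^ 2 * NE ^ 2 * (16 * Hr) ^ 2 / β ^ 2))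
      ≤ 8 * 12 ^ 2 * ((2 * C₂) ^ 2 * (3 * D ^ 2 * (4 * S ^ 4) ^ 2 * (8 * S) ^ 2 / β ^ 2)) := by gcongr
    _ = (8 * 144 * 4 * 3 * 4 ^ 2 * 8 ^ 2) * (C₂ ^ 2 * D ^ 2 * S ^ 10 * (β ^ 2)⁻¹) := by
        field_simp; ring
    _ ≤ 1 / 100 := by linarith

/-- The variance input of the cubic piece, `s₁ = K₁S⁶/β ≤ 1/320000`, once `K₁S⁶β⁻¹` is small. -/
theorem meanOne_le {K₁ S β : ℝ} (m6 : 320000 * (K₁ * S ^ 6 * β⁻¹) ≤ 1) : K₁ * S ^ 6 / β ≤ 1 / 320000 := by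
  rw [div_eq_mul_inv]; linarith

/-- The mean of the quartic dominator, `13440β·3D²N_E(16H)²/β² ≤ 1/400`, once `D²S⁶β⁻¹` is small. -/
theorem meanTwo_le {D S β NE Hr : ℝ} (hβ : 0 < β) (hNE : NE ≤ 4 * S ^ 4)
    (hH0 : 0 ≤ Hr) (hH : 16 * Hr ≤ 8 * S) (m7 : 400 * (13440 * 3 * 4 * 8 ^ 2) * (D ^ 2 * S ^ 6 * β⁻¹) ≤ 1) :
    13440 * β * (3 * D ^ 2 * NE * (16 * Hr) ^ 2 / β ^ 2) ≤ 1 / 400 := by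
  have h16 : 0 ≤ 16 * Hr := by positivity
  calc 13440 * β * (3 * D ^ 2 * NE * (16 * Hr) ^ 2 / β ^ 2) ≤ 13440 * β * (3 * D ^ 2 * (4 * S ^ 4) * (8 * S) ^ 2 / β ^ 2) := by
        gcongr
    _ = (13440 * 3 * 4 * 8 ^ 2) * (D ^ 2 * S ^ 6 * β⁻¹) := by
        field_simp
    _ ≤ 1 / 400 := by linarith

/-- The mean of the quadratic dominator, `2C₂·D·N_E·16H/β ≤ 1/400`, once `C₂DS⁵β⁻¹` is small. -/
theorem meanThree_le {D S β NE Hr C₂ : ℝ} (hD : 0 ≤ D) (hβ : 0 < β) (hC : 0 ≤ C₂)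
    (hNE : NE ≤ 4 * S ^ 4) (hH0 : 0 ≤ Hr) (hH : 16 * Hr ≤ 8 * S) (m8 : 400 * (2 * 4 * 8) * (C₂ * D * S ^ 5 * β⁻¹) ≤ 1) :
    2 * C₂ * (D * NE * (16 * Hr) / β) ≤ 1 / 400 := by
  calc 2 * C₂ * (D * NE * (16 * Hr) / β) ≤ 2 * C₂ * (D * (4 * S ^ 4) * (8 * S) / β) := by gcongr
    _ = (2 * 4 * 8) * (C₂ * D * S ^ 5 * β⁻¹) := by
        field_simp
    _ ≤ 1 / 400 := by linarith

end Algebra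

/-! ## §2 The thresholds, eventually in `β` -/

section Eventually

open Real

/-- `C·(2⌈β^θ⌉+3)^k·β^a ≤ 1` eventually, for `kθ + a < 0` (`θ > 0`). -/
theorem eventually_monomial_le_one (C : ℝ) (k : ℕ) {θ a : ℝ} (hθ : 0 < θ) (h : (k : ℝ) * θ + a < 0) :
    ∃ β₀ : ℝ, 1 ≤ β₀ ∧ ∀ β : ℝ, β₀ ≤ β → C * (2 * (⌈β ^ θ⌉₊ : ℝ) + 3) ^ k * β ^ a ≤ 1 := by
  obtain ⟨β₀, h1, h2⟩ := exists_const_mul_boxSide_pow_mul_rpow_le C k hθ (b := 0) h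
  exact ⟨β₀, h1, fun β hβ => by simpa only [Real.rpow_zero] using h2 β hβ⟩

/-- The box-side facts at `H = ⌈β^θ⌉ ≥ 1`: `16H ≤ 8S`, `#E_f ≤ 4S⁴`, `#touching ≤ 120S⁴` with `S = 2H+3`. -/
theorem boxSide_facts (H : ℕ) :
    16 * (H : ℝ) ≤ 8 * (2 * (H : ℝ) + 3) ∧
    (Fintype.card (ColdFreeIdx H) : ℝ) ≤ 4 * (2 * (H : ℝ) + 3) ^ 4 ∧
    (#(plaquettesTouching (AxialGauge.boxEdges 4 (2 * H + 1))) : ℝ) ≤ 120 * (2 * (H : ℝ) + 3) ^ 4 := by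
  refine ⟨by linarith, ?_, ?_⟩
  · have h1 : Fintype.card (ColdFreeIdx H) ≤ Fintype.card ↥(AxialGauge.boxEdges 4 (2 * H + 1)) := Fintype.card_subtype_le _
    rw [Fintype.card_coe] at h1
    have h2 := card_boxEdges_four_le (2 * H + 1)
    have h' : ((Fintype.card (ColdFreeIdx H) : ℕ) : ℝ) ≤ ((4 * (2 * H + 1) ^ 4 : ℕ) : ℝ) := by exact_mod_cast h1.trans h2
    push_cast at h'
    have h3 : (2 * (H : ℝ) + 1) ^ 4 ≤ (2 * (H : ℝ) + 3) ^ 4 := pow_le_pow_left₀ (by positivity) (by linarith) 4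
    linarith
  · have h := WeakCouplingRates.card_plaquettesTouching_boxEdges_le (2 * H + 1)
    have h' : ((#(plaquettesTouching (AxialGauge.boxEdges 4 (2 * H + 1))) : ℕ) : ℝ) ≤ ((120 * (2 * H + 1) ^ 4 : ℕ) : ℝ) := by
      exact_mod_cast h
    push_cast at h'
    have h3 : (2 * (H : ℝ) + 1) ^ 4 ≤ (2 * (H : ℝ) + 3) ^ 4 := pow_le_pow_left₀ (by positivity) (by linarith) 4
    linarith

/-- **The link radius against the box side**: `2·etaOf β H ε ≤ 9·(2H+3)²·β^{ε−1/2}` (`β > 0`). -/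
theorem two_mul_etaOf_le (H : ℕ) {β : ℝ} (hβ : 0 < β) (ε : ℝ) :
    2 * etaOf β H ε ≤ 9 * (2 * (H : ℝ) + 3) ^ 2 * β ^ (ε - 1 / 2) := by
  unfold etaOf
  have hsq : Real.sqrt (β ^ (2 * ε - 1)) = β ^ (ε - 1 / 2) := by
    rw [Real.sqrt_eq_rpow, ← Real.rpow_mul hβ.le]; congr 1; ring
  rw [hsq]
  have h2 : Real.sqrt 2 ≤ 3 / 2 := by
    rw [show (3 / 2 : ℝ) = Real.sqrt ((3 / 2) ^ 2) by rw [Real.sqrt_sq (by norm_num)]]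
    exact Real.sqrt_le_sqrt (by norm_num)
  have hP : 12 * (H : ℝ) ^ 2 + 2 * H + 1 ≤ 3 * (2 * (H : ℝ) + 3) ^ 2 := by nlinarith [sq_nonneg (H : ℝ)]
  have hu : 0 ≤ β ^ (ε - 1 / 2) := Real.rpow_nonneg hβ.le _
  calc 2 * ((12 * (H : ℝ) ^ 2 + 2 * H + 1) * (Real.sqrt 2 * β ^ (ε - 1 / 2)))
      ≤ 2 * ((3 * (2 * (H : ℝ) + 3) ^ 2) * ((3 / 2) * β ^ (ε - 1 / 2))) := by gcongr
    _ = 9 * (2 * (H : ℝ) + 3) ^ 2 * β ^ (ε - 1 / 2) := by ring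

/-- **The thresholds of the second clause of `TiltMoments`, eventually in `β`** (`0 < θ ≤ 1/16`, `r₂ > 0`, `C₂, K₁ ≥ 0`): beyond a threshold,
`β ≥ 10`, the link radius `R = 2·etaOf ≤ min(1/4, r₂)`, the three cap conditions `Δ₁, Δ₂, Δ₃ ≤ 1/100` (variance inputs
`s₁ = K₁(2H+3)⁶/β`, `ŝ₂ = (13440β)²·105D⁴#E_f²(16H)⁴/β⁴`, `ŝ₃ = (2C₂)²·3D²#E_f²(16H)²/β²`; caps `M₁ = 24·#touching·β·R³`, `M₂ = 13440β·#E_f·R⁴`,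
`M₃ = 2C₂·#E_f·R²`), and the three mean bounds (`s₁ ≤ 1/320000`, `E X₂, E X₃ ≤ 1/400`). -/
theorem eventually_expClauseThresholds {θ : ℝ} (hθ : 0 < θ) (hθ16 : θ ≤ 1 / 16) {r₂ : ℝ} (hr₂ : 0 < r₂) {C₂ K₁ : ℝ}
    (hC₂ : 0 ≤ C₂) (hK₁ : 0 ≤ K₁) :
    ∃ β₀ : ℝ, ∀ β : ℝ, β₀ ≤ β →
      10 ≤ β ∧
      2 * etaOf β ⌈β ^ θ⌉₊ (epsOf θ) ≤ 1 / 4 ∧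
      2 * etaOf β ⌈β ^ θ⌉₊ (epsOf θ) ≤ r₂ ∧
      Real.exp 1 ^ 2 * 12 ^ 2 * (K₁ * (2 * (⌈β ^ θ⌉₊ : ℝ) + 3) ^ 6 / β) *
          (12 * (24 * (#(plaquettesTouching (AxialGauge.boxEdges 4 (2 * ⌈β ^ θ⌉₊ + 1))) : ℝ) * β *
            (2 * etaOf β ⌈β ^ θ⌉₊ (epsOf θ)) ^ 3) + 4) ^ (3 - 2) ≤ 1 / 100 ∧
      Real.exp 1 ^ 2 * 12 ^ 2 * ((13440 * β) ^ 2 * (105 * (dimE ρ₂ : ℝ) ^ 4 * (Fintype.card (ColdFreeIdx ⌈β ^ θ⌉₊) : ℝ) ^ 2 *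
            (16 * (⌈β ^ θ⌉₊ : ℝ)) ^ 4 / β ^ 4)) *
          (12 * (13440 * β * ((Fintype.card (ColdFreeIdx ⌈β ^ θ⌉₊) : ℝ) * (2 * etaOf β ⌈β ^ θ⌉₊ (epsOf θ)) ^ 4)) + 4) ^ (4 - 2) ≤
        1 / 100 ∧
      Real.exp 1 ^ 2 * 12 ^ 2 * ((2 * C₂) ^ 2 * (3 * (dimE ρ₂ : ℝ) ^ 2 * (Fintype.card (ColdFreeIdx ⌈β ^ θ⌉₊) : ℝ) ^ 2 *
            (16 * (⌈β ^ θ⌉₊ : ℝ)) ^ 2 / β ^ 2)) *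
          (12 * (2 * C₂ * ((Fintype.card (ColdFreeIdx ⌈β ^ θ⌉₊) : ℝ) * (2 * etaOf β ⌈β ^ θ⌉₊ (epsOf θ)) ^ 2)) + 4) ^ (2 - 2) ≤
        1 / 100 ∧
      K₁ * (2 * (⌈β ^ θ⌉₊ : ℝ) + 3) ^ 6 / β ≤ 1 / 320000 ∧
      13440 * β * (3 * (dimE ρ₂ : ℝ) ^ 2 * (Fintype.card (ColdFreeIdx ⌈β ^ θ⌉₊) : ℝ) * (16 * (⌈β ^ θ⌉₊ : ℝ)) ^ 2 / β ^ 2) ≤ 1 / 400 ∧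
      2 * C₂ * ((dimE ρ₂ : ℝ) * (Fintype.card (ColdFreeIdx ⌈β ^ θ⌉₊) : ℝ) * (16 * (⌈β ^ θ⌉₊ : ℝ)) / β) ≤ 1 / 400 := by
  have hεθ : epsOf θ = 17 * θ / 8 := rfl
  -- the ten monomial thresholds
  obtain ⟨b₁, hb₁1, m_b1⟩ := eventually_monomial_le_one 36 2 hθ (a := epsOf θ - 1 / 2) (by rw [hεθ]; push_cast; linarith)
  obtain ⟨b₂, -, m_b2⟩ := eventually_monomial_le_one (9 / r₂) 2 hθ (a := epsOf θ - 1 / 2) (by rw [hεθ]; push_cast; linarith)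
  obtain ⟨b₃, -, m1⟩ := eventually_monomial_le_one (200 * (8 * 144 * 12 * 24 * 120 * 9 ^ 3) * K₁) 16 hθ
    (a := (epsOf θ - 1 / 2) * 3) (by rw [hεθ]; push_cast; linarith)
  obtain ⟨b₄, -, m2⟩ := eventually_monomial_le_one (200 * (8 * 144 * 4) * K₁) 6 hθ (a := -1) (by push_cast; linarith)
  obtain ⟨b₅, -, m3⟩ := eventually_monomial_le_one
    (200 * (8 * 144 * 288 * (13440 ^ 2 * 105 * 4 ^ 2 * 8 ^ 4) * (13440 ^ 2 * 4 ^ 2 * 9 ^ 8)) * (dimE ρ₂ : ℝ) ^ 4) 36 hθ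
    (a := (epsOf θ - 1 / 2) * 8) (by rw [hεθ]; push_cast; linarith)
  obtain ⟨b₆, -, m4⟩ := eventually_monomial_le_one (200 * (8 * 144 * 32 * (13440 ^ 2 * 105 * 4 ^ 2 * 8 ^ 4)) * (dimE ρ₂ : ℝ) ^ 4)
    12 hθ (a := -2) (by push_cast; linarith)
  obtain ⟨b₇, -, m5⟩ := eventually_monomial_le_one (100 * (8 * 144 * 4 * 3 * 4 ^ 2 * 8 ^ 2) * (C₂ ^ 2 * (dimE ρ₂ : ℝ) ^ 2)) 10 hθ
    (a := -2) (by push_cast; linarith)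
  obtain ⟨b₈, -, m6⟩ := eventually_monomial_le_one (320000 * K₁) 6 hθ (a := -1) (by push_cast; linarith)
  obtain ⟨b₉, -, m7⟩ := eventually_monomial_le_one (400 * (13440 * 3 * 4 * 8 ^ 2) * (dimE ρ₂ : ℝ) ^ 2) 6 hθ (a := -1)
    (by push_cast; linarith)
  obtain ⟨b₁₀, -, m8⟩ := eventually_monomial_le_one (400 * (2 * 4 * 8) * (C₂ * (dimE ρ₂ : ℝ))) 5 hθ (a := -1) (by push_cast; linarith)
  refine ⟨max (max (max (max b₁ b₂) (max b₃ b₄)) (max (max b₅ b₆) (max b₇ b₈))) (max (max b₉ b₁₀) 10), fun β hβ => ?_⟩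
  have hA : max (max (max b₁ b₂) (max b₃ b₄)) (max (max b₅ b₆) (max b₇ b₈)) ≤ β := (le_max_left _ _).trans hβ
  have hB : max (max b₉ b₁₀) 10 ≤ β := (le_max_right _ _).trans hβ
  have hβ₁ : b₁ ≤ β := le_trans (le_trans (le_trans (le_max_left _ _) (le_max_left _ _)) (le_max_left _ _)) hA
  have hβ₂ : b₂ ≤ β := le_trans (le_trans (le_trans (le_max_right _ _) (le_max_left _ _)) (le_max_left _ _)) hA
  have hβ₃ : b₃ ≤ β := le_trans (le_trans (le_trans (le_max_left _ _) (le_max_right _ _)) (le_max_left _ _)) hA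
  have hβ₄ : b₄ ≤ β := le_trans (le_trans (le_trans (le_max_right _ _) (le_max_right _ _)) (le_max_left _ _)) hA
  have hβ₅ : b₅ ≤ β := le_trans (le_trans (le_trans (le_max_left _ _) (le_max_left _ _)) (le_max_right _ _)) hA
  have hβ₆ : b₆ ≤ β := le_trans (le_trans (le_trans (le_max_right _ _) (le_max_left _ _)) (le_max_right _ _)) hA
  have hβ₇ : b₇ ≤ β := le_trans (le_trans (le_trans (le_max_left _ _) (le_max_right _ _)) (le_max_right _ _)) hA
  have hβ₈ : b₈ ≤ β := le_trans (le_trans (le_trans (le_max_right _ _) (le_max_right _ _)) (le_max_right _ _)) hA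
  have hβ₉ : b₉ ≤ β := le_trans (le_trans (le_max_left _ _) (le_max_left _ _)) hB
  have hβ₁₀ : b₁₀ ≤ β := le_trans (le_trans (le_max_right _ _) (le_max_left _ _)) hB
  have hβ10 : 10 ≤ β := le_trans (le_max_right _ _) hB
  have hβ1 : 1 ≤ β := hb₁1.trans hβ₁
  have hβ0 : 0 < β := by linarith
  -- box-side facts
  obtain ⟨h16, hNE, hNP⟩ := boxSide_facts ⌈β ^ θ⌉₊
  have hH0 : (0 : ℝ) ≤ (⌈β ^ θ⌉₊ : ℝ) := Nat.cast_nonneg _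
  have hNE0 : (0 : ℝ) ≤ (Fintype.card (ColdFreeIdx ⌈β ^ θ⌉₊) : ℝ) := Nat.cast_nonneg _
  have hNP0 : (0 : ℝ) ≤ (#(plaquettesTouching (AxialGauge.boxEdges 4 (2 * ⌈β ^ θ⌉₊ + 1))) : ℝ) := Nat.cast_nonneg _
  have hD0 : (0 : ℝ) ≤ (dimE ρ₂ : ℝ) := Nat.cast_nonneg _
  -- the radius
  have hu0 : 0 ≤ β ^ (epsOf θ - 1 / 2) := Real.rpow_nonneg hβ0.le _
  have hR : 2 * etaOf β ⌈β ^ θ⌉₊ (epsOf θ) ≤ 9 * (2 * (⌈β ^ θ⌉₊ : ℝ) + 3) ^ 2 * β ^ (epsOf θ - 1 / 2) :=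
    two_mul_etaOf_le ⌈β ^ θ⌉₊ hβ0 (epsOf θ)
  have hR0 : 0 ≤ 2 * etaOf β ⌈β ^ θ⌉₊ (epsOf θ) := by unfold etaOf; positivity
  -- powers of `u = β^{ε−1/2}` and of `β` as real powers
  have hu3 : (β ^ (epsOf θ - 1 / 2)) ^ 3 = β ^ ((epsOf θ - 1 / 2) * 3) := by
    rw [← Real.rpow_natCast, ← Real.rpow_mul hβ0.le]; norm_num
  have hu8 : (β ^ (epsOf θ - 1 / 2)) ^ 8 = β ^ ((epsOf θ - 1 / 2) * 8) := by
    rw [← Real.rpow_natCast, ← Real.rpow_mul hβ0.le]; norm_num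
  have hi1 : β⁻¹ = β ^ (-1 : ℝ) := (Real.rpow_neg_one β).symm
  have hi2 : (β ^ 2)⁻¹ = β ^ (-2 : ℝ) := by rw [Real.rpow_neg hβ0.le, Real.rpow_two]
  -- the monomials in the shape of §1
  have m1' : 200 * (8 * 144 * 12 * 24 * 120 * 9 ^ 3) * (K₁ * (2 * (⌈β ^ θ⌉₊ : ℝ) + 3) ^ 16 * (β ^ (epsOf θ - 1 / 2)) ^ 3) ≤ 1 := by
    have h := m1 β hβ₃; rw [← hu3] at h; linarith [h]
  have m2' : 200 * (8 * 144 * 4) * (K₁ * (2 * (⌈β ^ θ⌉₊ : ℝ) + 3) ^ 6 * β⁻¹) ≤ 1 := by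
    have h := m2 β hβ₄; rw [← hi1] at h; linarith [h]
  have m3' : 200 * (8 * 144 * 288 * (13440 ^ 2 * 105 * 4 ^ 2 * 8 ^ 4) * (13440 ^ 2 * 4 ^ 2 * 9 ^ 8)) *
      ((dimE ρ₂ : ℝ) ^ 4 * (2 * (⌈β ^ θ⌉₊ : ℝ) + 3) ^ 36 * (β ^ (epsOf θ - 1 / 2)) ^ 8) ≤ 1 := by
    have h := m3 β hβ₅; rw [← hu8] at h; linarith [h]
  have m4' : 200 * (8 * 144 * 32 * (13440 ^ 2 * 105 * 4 ^ 2 * 8 ^ 4)) *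
      ((dimE ρ₂ : ℝ) ^ 4 * (2 * (⌈β ^ θ⌉₊ : ℝ) + 3) ^ 12 * (β ^ 2)⁻¹) ≤ 1 := by
    have h := m4 β hβ₆; rw [← hi2] at h; linarith [h]
  have m5' : 100 * (8 * 144 * 4 * 3 * 4 ^ 2 * 8 ^ 2) * (C₂ ^ 2 * (dimE ρ₂ : ℝ) ^ 2 * (2 * (⌈β ^ θ⌉₊ : ℝ) + 3) ^ 10 * (β ^ 2)⁻¹) ≤ 1 := by
    have h := m5 β hβ₇; rw [← hi2] at h; linarith [h]
  have m6' : 320000 * (K₁ * (2 * (⌈β ^ θ⌉₊ : ℝ) + 3) ^ 6 * β⁻¹) ≤ 1 := by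
    have h := m6 β hβ₈; rw [← hi1] at h; linarith [h]
  have m7' : 400 * (13440 * 3 * 4 * 8 ^ 2) * ((dimE ρ₂ : ℝ) ^ 2 * (2 * (⌈β ^ θ⌉₊ : ℝ) + 3) ^ 6 * β⁻¹) ≤ 1 := by
    have h := m7 β hβ₉; rw [← hi1] at h; linarith [h]
  have m8' : 400 * (2 * 4 * 8) * (C₂ * (dimE ρ₂ : ℝ) * (2 * (⌈β ^ θ⌉₊ : ℝ) + 3) ^ 5 * β⁻¹) ≤ 1 := by
    have h := m8 β hβ₁₀; rw [← hi1] at h; linarith [h]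
  -- `e² ≤ 8` (cf. `Literature.Computability.MetaComplexity.exp_one_sq_le_eight`; re-derived inline from `Real.exp_one_lt_d9`)
  have he8 : Real.exp 1 ^ 2 ≤ 8 :=
    (pow_lt_pow_left₀ Real.exp_one_lt_d9 (Real.exp_pos 1).le two_ne_zero).le.trans (by norm_num)
  refine ⟨hβ10, ?_, ?_, ?_, ?_, ?_, meanOne_le m6', meanTwo_le hβ0 hNE hH0 h16 m7', meanThree_le hD0 hβ0 hC₂ hNE hH0 h16 m8'⟩
  · have h := m_b1 β hβ₁; linarith
  · have h := m_b2 β hβ₂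
    have h' : r₂ * (9 / r₂ * (2 * (⌈β ^ θ⌉₊ : ℝ) + 3) ^ 2 * β ^ (epsOf θ - 1 / 2)) ≤ r₂ * 1 := mul_le_mul_of_nonneg_left h hr₂.le
    have he : r₂ * (9 / r₂ * (2 * (⌈β ^ θ⌉₊ : ℝ) + 3) ^ 2 * β ^ (epsOf θ - 1 / 2)) =
        9 * (2 * (⌈β ^ θ⌉₊ : ℝ) + 3) ^ 2 * β ^ (epsOf θ - 1 / 2) := by field_simp
    linarith
  · exact deltaOne_le he8 hK₁ hu0 hβ0 hNP0 hNP hR0 hR m1' m2'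
  · exact deltaTwo_le he8 hβ0 hNE0 hNE hH0 h16 hR0 hR m3' m4'
  · exact deltaThree_le he8 hβ0 hNE0 hNE hH0 h16 m5'

end Eventually

end Summit.QuantumFields.YangMills.Theorems.AllWindowsColdBoxBoxMidLine

end
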